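import Mathlib
import Summits.Ventures.PercRepro.TriangleCapFirstGap

/-!
# PercRepro — THE TOP OF THE BAND ON `n` VERTICES, EXACTLY: THE TWO FIRST SUB-BANDS (p3, gen 52; part 254)

On `ℓ + 1 + (s − t)` vertices (`2 ≤ ℓ`, `ℓ + 3 ≤ t`, `2 t ≤ s`) the band values `j ≤ t + ℓ − 3` of the pair-count
spectrum are EXACTLY `j ≤ ℓ − 1` (the star sub-band `u = 0`: the `t`-star at a non-neighbour with `j` ends at
non-neighbours, `starWitness`) and `t − 2 ≤ j ≤ t + ℓ − 3` (the sub-band `u = 1`: the `(t − 1)`-star plus one edge at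
a second non-neighbour — ending at a leaf of the star (`oneWitness`, `j = t − 2 + k`) or at a fresh leaf
(`oneWitness'`, `j = t − 1 + k`), with `k ≤ ℓ − 2` star ends at non-neighbours); the gap `ℓ ≤ j ≤ t − 3` between them
is part 253.  All three families are pair witnesses (part 245) with explicit ends.  Axioms: standard.
-/

namespace PercRepro

namespace TriangleCap

namespace C047

open Finset

/-- The right ends of the star witness: `j` non-leaves, then `t − j` leaves. -/
def rfStar (s t j i : ℕ) : ℕ := if i < j then 2 + (s - t) + i else 2 + (i - j)

/-- The left ends of the one-edge witnesses: `1` for the star, `2` for the extra edge. -/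
def lfOne (t i : ℕ) : ℕ := if i < t - 1 then 1 else 2

/-- The right ends of the one-edge witness ending at a leaf of the star: `t − 1 − k` leaves, `k` non-leaves, then
the first leaf again. -/
def rfOne (s t k i : ℕ) : ℕ :=
  if i < t - 1 - k then 3 + i else if i < t - 1 then 3 + (s - t) + (i - (t - 1 - k)) else 3

/-- The right ends of the one-edge witness ending at a fresh leaf. -/
def rfOne' (s t k i : ℕ) : ℕ :=
  if i < t - 1 - k then 3 + i else if i < t - 1 then 3 + (s - t) + (i - (t - 1 - k)) else 3 + (t - 1 - k)

/-- `coll` of an injective map on `range t` is `0`. -/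
theorem coll_eq_zero_of_injOn (t : ℕ) (rf : ℕ → ℕ) (h : ∀ i i', i < t → i' < t → rf i = rf i' → i = i') :
    coll t rf = 0 := by
  unfold coll
  rw [card_eq_zero, filter_eq_empty_iff]
  intro p hp
  rw [mem_offDiag, mem_range, mem_range] at hp
  intro heq
  exact hp.2.2 (h _ _ hp.1 hp.2.1 heq)

/-- `coll` of the star ends with one leaf repeated: `(0, t − 1)` and `(t − 1, 0)` collide and nothing else. -/
theorem coll_rfOne (s t k : ℕ) (ht : 2 ≤ t) (hk : k + 2 ≤ t) (hs : 2 * t ≤ s) :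
    coll t (rfOne s t k) = 2 := by
  unfold coll
  have hset : (range t).offDiag.filter (fun p : ℕ × ℕ => rfOne s t k p.1 = rfOne s t k p.2) =
      {(0, t - 1), (t - 1, 0)} := by
    ext ⟨i, i'⟩
    simp only [mem_filter, mem_offDiag, mem_range, mem_insert, mem_singleton, Prod.mk.injEq]
    unfold rfOne
    constructor
    · rintro ⟨⟨h1, h2, h3⟩, h4⟩
      split_ifs at h4 <;> omega
    · rintro (⟨rfl, rfl⟩ | ⟨rfl, rfl⟩)
      · refine ⟨⟨by omega, by omega, by omega⟩, ?_⟩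
        split_ifs <;> omega
      · refine ⟨⟨by omega, by omega, by omega⟩, ?_⟩
        split_ifs <;> omega
  rw [hset, card_pair]
  intro h
  rw [Prod.mk.injEq] at h
  omega

/-- `coll` of the one-edge left ends: `(t − 1)(t − 2)`. -/
theorem coll_lfOne (t : ℕ) (ht : 2 ≤ t) : coll t (lfOne t) = (t - 1) * (t - 2) := by
  rw [coll_eq_sum_cls t (lfOne t) {1, 2} (fun i _ => by
    simp only [mem_insert, mem_singleton]
    unfold lfOne
    split_ifs <;> omega)]
  rw [sum_pair (by norm_num)]
  have h1 : cls t (lfOne t) 1 = t - 1 := by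
    unfold cls
    have : (range t).filter (fun i => lfOne t i = 1) = range (t - 1) := by
      ext i
      simp only [mem_filter, mem_range]
      unfold lfOne
      split_ifs <;> omega
    rw [this, card_range]
  have h2 : cls t (lfOne t) 2 = 1 := by
    unfold cls
    have : (range t).filter (fun i => lfOne t i = 2) = {t - 1} := by
      ext i
      simp only [mem_filter, mem_range, mem_singleton]
      unfold lfOne
      split_ifs <;> omega
    rw [this, card_singleton]
  rw [h1, h2]
  have : t - 1 - 1 = t - 2 := by omega
  rw [this]
  ring

/-- **THE STAR SUB-BAND:** every `j ≤ ℓ − 1` is attained on `ℓ + 1 + (s − t)` vertices (`1 ≤ t`, `2 t ≤ s`): the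
`t`-star at a non-neighbour of `w` with `j` ends at non-neighbours and `t − j` at leaves. -/
theorem starWitness (ℓ s t j : ℕ) (ht : 1 ≤ t) (hs : 2 * t ≤ s) (hj : j + 1 ≤ ℓ) (hjt : j ≤ t) :
    ∃ (H : SimpleGraph (Fin (ℓ + 1 + (s - t)))) (_ : DecidableRel H.Adj), H.CliqueFree 3 ∧
      H.edgeFinset.card = s ∧ (∃ w, deg H w + t = s) ∧
      ∑ v, deg H v * deg H v + 2 * (t * (s - t - 1)) + 2 * j = s * (s + 1) := by
  set n := ℓ + 1 + (s - t) with hn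
  have hn0 : 0 < n := by omega
  have hg : GoodEnds n 2 t (lfRR 1 t) (rfStar s t j) := by
    refine ⟨fun i hi => ?_, fun i hi => ?_, fun i i' hi hi' _ h2 => ?_⟩
    · have := lfRR_bounds 1 t i (by omega)
      omega
    · unfold rfStar
      split_ifs <;> omega
    · unfold rfStar at h2
      split_ifs at h2 <;> omega
  have hval := genWitness_missing_value n 2 s t hn0 (lfRR 1 t) (rfStar s t j) hg (by omega) ht (by omega)
    (by omega)
  have hatt : ((range t).filter (fun i => rfStar s t j i < 2 + (s - t))).card = t - j := by
    have : (range t).filter (fun i => rfStar s t j i < 2 + (s - t)) = Ico j t := by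
      ext i
      simp only [mem_filter, mem_range, mem_Ico]
      unfold rfStar
      split_ifs <;> omega
    rw [this, Nat.card_Ico]
  have hrf : coll t (rfStar s t j) = 0 := by
    apply coll_eq_zero_of_injOn
    intro i i' hi hi' h
    unfold rfStar at h
    split_ifs at h <;> omega
  rw [hatt, hrf, coll_lfRR_top, Nat.add_zero, Nat.sub_self, Nat.add_zero] at hval
  refine ⟨_, inferInstance, cliqueFree_of_bipSub _ _ (bipSub_missingGraph _ _),
    card_edges_missingGraph_genWitness n 2 s t hn0 (lfRR 1 t) (rfStar s t j) hg (by omega) (by omega) (by omega),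
    ⟨fin' n hn0 0, by
      rw [deg_missingGraph_genWitness_zero n 2 s t hn0 (lfRR 1 t) (rfStar s t j) hg (by omega) (by omega)]
      omega⟩, ?_⟩
  have e : t - (t - j) = j := by omega
  rw [e] at hval
  exact hval

/-- The attach count of the one-edge witnesses: the `t − 1 − k` leaves of the star and the last pair. -/
theorem card_filter_one (s t k : ℕ) (rf : ℕ → ℕ) (ht : 2 ≤ t) (hk : k + 1 ≤ t)
    (h1 : ∀ i, i < t - 1 - k → rf i < 3 + (s - t)) (h2 : ∀ i, t - 1 - k ≤ i → i < t - 1 → 3 + (s - t) ≤ rf i)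
    (h3 : rf (t - 1) < 3 + (s - t)) :
    ((range t).filter (fun i => rf i < 3 + (s - t))).card = t - k := by
  have : (range t).filter (fun i => rf i < 3 + (s - t)) = insert (t - 1) (range (t - 1 - k)) := by
    ext i
    simp only [mem_filter, mem_range, mem_insert]
    constructor
    · rintro ⟨hi, hlt⟩
      by_cases hc : i < t - 1 - k
      · exact Or.inr hc
      · by_cases hc' : i < t - 1
        · have := h2 i (by omega) hc'
          omega
        · left
          omega
    · rintro (rfl | hi)
      · exact ⟨by omega, h3⟩
      · exact ⟨by omega, h1 i hi⟩
  rw [this, card_insert_of_notMem (by rw [mem_range]; omega), card_range]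
  omega

/-- **THE SUB-BAND `u = 1`, LEAF END:** `j = t − 2 + k` is attained for `k ≤ ℓ − 2`, `k + 2 ≤ t`, `2 t ≤ s`: the
`(t − 1)`-star at a non-neighbour (`k` ends at non-neighbours) plus an edge from a second non-neighbour to a leaf
of the star. -/
theorem oneWitness (ℓ s t k : ℕ) (ht : 2 ≤ t) (hs : 2 * t ≤ s) (hk : k + 2 ≤ ℓ) (hkt : k + 2 ≤ t) :
    ∃ (H : SimpleGraph (Fin (ℓ + 1 + (s - t)))) (_ : DecidableRel H.Adj), H.CliqueFree 3 ∧
      H.edgeFinset.card = s ∧ (∃ w, deg H w + t = s) ∧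
      ∑ v, deg H v * deg H v + 2 * (t * (s - t - 1)) + 2 * (t - 2 + k) = s * (s + 1) := by
  set n := ℓ + 1 + (s - t) with hn
  have hn0 : 0 < n := by omega
  have hg : GoodEnds n 3 t (lfOne t) (rfOne s t k) := by
    refine ⟨fun i hi => ?_, fun i hi => ?_, fun i i' hi hi' h1 h2 => ?_⟩
    · unfold lfOne
      split_ifs <;> omega
    · unfold rfOne
      split_ifs <;> omega
    · unfold lfOne at h1
      unfold rfOne at h2
      split_ifs at h1 h2 <;> omega
  have hval := genWitness_missing_value n 3 s t hn0 (lfOne t) (rfOne s t k) hg (by omega) (by omega) (by omega)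
    (by omega)
  have hatt := card_filter_one s t k (rfOne s t k) ht (by omega)
    (fun i hi => by unfold rfOne; rw [if_pos hi]; omega)
    (fun i hi hi' => by unfold rfOne; rw [if_neg (by omega), if_pos hi']; omega)
    (by unfold rfOne; rw [if_neg (by omega), if_neg (by omega)]; omega)
  rw [hatt, coll_lfOne t ht, coll_rfOne s t k ht hkt hs] at hval
  refine ⟨_, inferInstance, cliqueFree_of_bipSub _ _ (bipSub_missingGraph _ _),
    card_edges_missingGraph_genWitness n 3 s t hn0 (lfOne t) (rfOne s t k) hg (by omega) (by omega) (by omega),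
    ⟨fin' n hn0 0, by
      rw [deg_missingGraph_genWitness_zero n 3 s t hn0 (lfOne t) (rfOne s t k) hg (by omega) (by omega)]
      omega⟩, ?_⟩
  have e1 : t - (t - k) = k := by omega
  have e2 : t * (t - 1) - ((t - 1) * (t - 2) + 2) = 2 * (t - 2) := by
    obtain ⟨t', rfl⟩ : ∃ t', t = t' + 2 := ⟨t - 2, by omega⟩
    have : t' + 2 - 1 = t' + 1 := by omega
    have h' : t' + 2 - 2 = t' := by omega
    rw [this, h']
    have : (t' + 2) * (t' + 1) = (t' + 1) * t' + 2 + 2 * t' := by ring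
    rw [this, Nat.add_sub_cancel_left]
  rw [e1, e2] at hval
  have e3 : 2 * (t - 2 + k) = 2 * k + 2 * (t - 2) := by ring
  rw [e3]
  exact hval

/-- **THE SUB-BAND `u = 1`, FRESH END:** `j = t − 1 + k` is attained for `k ≤ ℓ − 2`, `k + 1 ≤ t`, `2 ≤ t`,
`2 t ≤ s`: the `(t − 1)`-star (`k` ends at non-neighbours) plus an edge from a second non-neighbour to a fresh
leaf. -/
theorem oneWitness' (ℓ s t k : ℕ) (ht : 2 ≤ t) (hs : 2 * t ≤ s) (hk : k + 2 ≤ ℓ) (hkt : k + 1 ≤ t) :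
    ∃ (H : SimpleGraph (Fin (ℓ + 1 + (s - t)))) (_ : DecidableRel H.Adj), H.CliqueFree 3 ∧
      H.edgeFinset.card = s ∧ (∃ w, deg H w + t = s) ∧
      ∑ v, deg H v * deg H v + 2 * (t * (s - t - 1)) + 2 * (t - 1 + k) = s * (s + 1) := by
  set n := ℓ + 1 + (s - t) with hn
  have hn0 : 0 < n := by omega
  have hg : GoodEnds n 3 t (lfOne t) (rfOne' s t k) := by
    refine ⟨fun i hi => ?_, fun i hi => ?_, fun i i' hi hi' h1 h2 => ?_⟩
    · unfold lfOne
      split_ifs <;> omega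
    · unfold rfOne'
      split_ifs <;> omega
    · unfold lfOne at h1
      unfold rfOne' at h2
      split_ifs at h1 h2 <;> omega
  have hval := genWitness_missing_value n 3 s t hn0 (lfOne t) (rfOne' s t k) hg (by omega) (by omega) (by omega)
    (by omega)
  have hatt := card_filter_one s t k (rfOne' s t k) ht hkt
    (fun i hi => by unfold rfOne'; rw [if_pos hi]; omega)
    (fun i hi hi' => by unfold rfOne'; rw [if_neg (by omega), if_pos hi']; omega)
    (by unfold rfOne'; rw [if_neg (by omega), if_neg (by omega)]; omega)
  have hrf : coll t (rfOne' s t k) = 0 := by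
    apply coll_eq_zero_of_injOn
    intro i i' hi hi' h
    unfold rfOne' at h
    split_ifs at h <;> omega
  rw [hatt, coll_lfOne t ht, hrf, Nat.add_zero] at hval
  refine ⟨_, inferInstance, cliqueFree_of_bipSub _ _ (bipSub_missingGraph _ _),
    card_edges_missingGraph_genWitness n 3 s t hn0 (lfOne t) (rfOne' s t k) hg (by omega) (by omega) (by omega),
    ⟨fin' n hn0 0, by
      rw [deg_missingGraph_genWitness_zero n 3 s t hn0 (lfOne t) (rfOne' s t k) hg (by omega) (by omega)]
      omega⟩, ?_⟩
  have e1 : t - (t - k) = k := by omega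
  have e2 : t * (t - 1) - (t - 1) * (t - 2) = 2 * (t - 1) := by
    obtain ⟨t', rfl⟩ : ∃ t', t = t' + 2 := ⟨t - 2, by omega⟩
    have : t' + 2 - 1 = t' + 1 := by omega
    have h' : t' + 2 - 2 = t' := by omega
    rw [this, h']
    have : (t' + 2) * (t' + 1) = (t' + 1) * t' + 2 * (t' + 1) := by ring
    rw [this, Nat.add_sub_cancel_left]
  rw [e1, e2] at hval
  have e3 : 2 * (t - 1 + k) = 2 * k + 2 * (t - 1) := by ring
  rw [e3]
  exact hval

/-- **THE TOP OF THE BAND ON `n` VERTICES, EXACTLY:** for `2 ≤ ℓ`, `ℓ + 3 ≤ t`, `2 t ≤ s` and `j ≤ t + ℓ − 3`, the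
band value `2 j` is attained on `ℓ + 1 + (s − t)` vertices iff `j ≤ ℓ − 1` or `t − 2 ≤ j`. -/
theorem top_of_band_vertices_iff (ℓ s t j : ℕ) (hℓ : 2 ≤ ℓ) (ht : ℓ + 3 ≤ t) (hs : 2 * t ≤ s)
    (hj : j + 3 ≤ t + ℓ) :
    (∃ (H : SimpleGraph (Fin (ℓ + 1 + (s - t)))) (_ : DecidableRel H.Adj), H.CliqueFree 3 ∧
      H.edgeFinset.card = s ∧ (∃ w, deg H w + t = s) ∧
      ∑ v, deg H v * deg H v + 2 * (t * (s - t - 1)) + 2 * j = s * (s + 1)) ↔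
    (j + 1 ≤ ℓ ∨ t ≤ j + 2) := by
  constructor
  · rintro ⟨H, _, hfree, hs', ⟨w, hw⟩, hj'⟩
    exact first_gap_vertices ℓ s t H hfree hs' w hw (by omega) j hj'
  · rintro (h | h)
    · exact starWitness ℓ s t j (by omega) hs h (by omega)
    · by_cases hc : j + 4 ≤ t + ℓ
      · obtain ⟨k, hk⟩ : ∃ k, j = t - 2 + k := ⟨j - (t - 2), by omega⟩
        rw [hk]
        exact oneWitness ℓ s t k (by omega) hs (by omega) (by omega)
      · obtain ⟨k, hk⟩ : ∃ k, j = t - 1 + k := ⟨j - (t - 1), by omega⟩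
        rw [hk]
        exact oneWitness' ℓ s t k (by omega) hs (by omega) (by omega)

end C047

end TriangleCap

end PercRepro
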